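import Literature.AlgebraicGeometry.Motives.FlatSubfamilyProofs
import Literature.AlgebraicTopology.Homotopy.LocallyTrivialSerre
import HarnessLib

/-!
# Ehresmann for smooth proper families: `f(ℂ)` is a locally trivial fibration (proved)

Area `Literature/AlgebraicGeometry/Motives`. For a morphism `f : 𝒳 ⟶ U` of `ℂ`-schemes of finite
type with `U → Spec ℂ` smooth and `f` smooth and proper, the map on complex points
`f(ℂ) : 𝒳(ℂ) → U(ℂ)` is a locally trivial fibration in the sense of Bröcker–Jänich (8.12)
(`isLocallyTrivialFibration_map_of_smooth_proper`; fibres may vary between components of the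
base). This is Steps 1–4 of the tree's discharge `Voisin2002_tubeRestrict_isIso_holds` (file
`FlatSubfamilyProofs`) verbatim, stopping before the contraction step: an affine smooth base chart
`B ∋ t₀` and its equidimensional piece, `E = f⁻¹B`, the equidimensional pieces `E_N` of `E`
(`exists_smoothPieces`), Ehresmann's theorem for the proper submersions `E_N(ℂ) → B(ℂ)`
(`ehresmann_fibration_holds`), and gluing over the clopen pieces (`exists_trivialization_of_pieces`).
It is the "`π : 𝒳(ℂ) → U(ℂ)` is a fibration" input of Deligne's invariant cycle theorem (Voisin II,
Thm. 4.15/4.18) and, with `IsLocallyTrivialFibration.isSerreFibration`, makes `f(ℂ)` a Serre fibration.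

Everything is proved; no named fact (D-0026).

## References

* C. Voisin, *Hodge Theory and Complex Algebraic Geometry I*, CUP 2002, Thm. 9.3, §9.2.1.
  [VoisinHodgeI2002]
* Th. Bröcker, K. Jänich, *Introduction to Differential Topology*, (8.12). [BrockerJanichIDT1982]
* A. Grothendieck, M. Raynaud, *SGA 1*, Exp. XII, Prop. 3.1 (iv), 3.2 (v). [SGA1]
-/

noncomputable section

open CategoryTheory AlgebraicGeometry Filter Topology TopologicalSpace Set
open scoped Manifold ContDiff
open Literature.AlgebraicTopology.SingularHomology
open Literature.AlgebraicTopology.Homotopy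

namespace Literature.AlgebraicGeometry.Motives

/-- **Ehresmann for smooth proper families**: for `f : 𝒳 ⟶ U` smooth and proper over a smooth
`ℂ`-scheme `U`, `f(ℂ) : 𝒳(ℂ) → U(ℂ)` is a locally trivial fibration (Bröcker–Jänich (8.12) piece by
equidimensional piece, glued over the clopen pieces; Voisin I Thm. 9.3).
[cite: VoisinHodgeI2002, Thm. 9.3 and §9.2.1] [cite: BrockerJanichIDT1982, (8.12)]
[cite: SGA1, Exp. XII Prop. 3.1 (iv) and Prop. 3.2 (v)] -/
theorem isLocallyTrivialFibration_map_of_smooth_proper {U 𝒳 : SchemeOver ℂ} (f : 𝒳 ⟶ U)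
    [Smooth U.hom] [Smooth f.left] [IsProper f.left] :
    IsLocallyTrivialFibration (AlgPoints.map f : ComplexPoints 𝒳 → ComplexPoints U) := by
  intro t₀
  classical
  haveI : IsLocallyNoetherian U.left := LocallyOfFiniteType.isLocallyNoetherian U.hom
  -- Step 1: an affine open `V₀ ∋ t₀` and its equidimensional piece `B` through `t₀`
  obtain ⟨V₀, hV₀, ht₀V₀⟩ : ∃ V₀ : U.left.Opens, IsAffineOpen V₀ ∧ t₀.pt ∈ V₀ := by
    obtain ⟨_, ⟨V₀, hV₀', rfl⟩, ht₀V₀, -⟩ :=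
      U.left.isBasis_affineOpens.exists_subset_of_mem_open (Set.mem_univ t₀.pt) isOpen_univ
    exact ⟨V₀, hV₀', ht₀V₀⟩
  haveI : IsAffine (V₀ : Scheme) := hV₀
  let B' : SchemeOver ℂ := Over.mk (V₀.ι ≫ U.hom)
  haveI : Smooth B'.hom := inferInstanceAs (Smooth (V₀.ι ≫ U.hom))
  haveI : IsSeparated B'.hom := inferInstanceAs (IsSeparated (V₀.ι ≫ U.hom))
  haveI : CompactSpace B'.left := inferInstanceAs (CompactSpace (V₀ : Scheme))
  obtain ⟨pieceB, hBsm, hBcov, -, -⟩ := exists_smoothPieces B'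
  let ιB' : B' ⟶ U := Over.homMk V₀.ι
  haveI : IsOpenImmersion ιB'.left := inferInstanceAs (IsOpenImmersion V₀.ι)
  let t₀' : ComplexPoints B' := AlgPoints.liftOfMemOpensRange ιB' t₀ (by
    change t₀.pt ∈ (V₀.ι).opensRange
    rw [Scheme.Opens.opensRange_ι]; exact ht₀V₀)
  have ht₀' : AlgPoints.map ιB' t₀' = t₀ := AlgPoints.map_liftOfMemOpensRange ιB' t₀ _
  obtain ⟨m, hm⟩ := hBcov t₀'.pt
  -- the open `WB ⊆ U` underlying the piece, and `B := WB` as an open subscheme of `U`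
  let WB : U.left.Opens := V₀.ι ''ᵁ pieceB m
  have hWBV₀ : WB ≤ V₀ := by
    intro x hx
    obtain ⟨y, -, rfl⟩ := hx
    exact y.2
  have ht₀WB : t₀.pt ∈ WB := by
    refine ⟨t₀'.pt, hm, ?_⟩
    rw [← ht₀']
    rfl
  let B : SchemeOver ℂ := Over.mk (WB.ι ≫ U.hom)
  let ιB : B ⟶ U := Over.homMk WB.ι
  haveI : IsOpenImmersion ιB.left := inferInstanceAs (IsOpenImmersion WB.ι)
  -- `B → Spec ℂ` is smooth of relative dimension `m`: transfer from the piece along `piece ≅ WB`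
  haveI : SmoothOfRelativeDimension m B.hom := by
    have h1 : SmoothOfRelativeDimension m ((pieceB m).ι ≫ V₀.ι ≫ U.hom) := hBsm m
    haveI : @IsOpenImmersion B'.left U.left (Scheme.Opens.ι V₀) :=
      inferInstanceAs (IsOpenImmersion (Scheme.Opens.ι V₀))
    haveI : IsOpenImmersion ((pieceB m).ι ≫ V₀.ι) := IsOpenImmersion.comp _ _
    have hrange : Set.range ((pieceB m).ι ≫ V₀.ι).base = Set.range WB.ι.base := by
      rw [Scheme.Hom.comp_base, TopCat.coe_comp, Set.range_comp, Scheme.Opens.range_ι,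
        Scheme.Opens.range_ι]
      rfl
    let e := IsOpenImmersion.isoOfRangeEq ((pieceB m).ι ≫ V₀.ι) WB.ι hrange
    have h2 : (pieceB m).ι ≫ V₀.ι ≫ U.hom = e.hom ≫ (WB.ι ≫ U.hom) := by
      rw [← Category.assoc, ← IsOpenImmersion.isoOfRangeEq_hom_fac ((pieceB m).ι ≫ V₀.ι) WB.ι hrange,
        Category.assoc]
    rw [h2, MorphismProperty.cancel_left_of_respectsIso (@SmoothOfRelativeDimension m)] at h1
    exact h1
  haveI : LocallyOfFiniteType B.hom := by
    haveI : Smooth B.hom := SmoothOfRelativeDimension.smooth m _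
    infer_instance
  haveI : IsSeparated B.hom := by
    change IsSeparated (WB.ι ≫ U.hom)
    rw [← U.left.homOfLE_ι hWBV₀, Category.assoc]
    infer_instance
  -- `B(ℂ)`: Hausdorff, second countable, a real `2m`-manifold; the base point `b₀` over `t₀`
  haveI : T2Space (ComplexPoints B) := ComplexPoints.t2Space_of_isSeparated B
  haveI : LocallyOfFiniteType B'.hom := inferInstance
  haveI : SecondCountableTopology (ComplexPoints B') :=
    ComplexPoints.secondCountableTopology_of_compactSpace_holds B'
  haveI : SecondCountableTopology (ComplexPoints B) := by
    let κ : B ⟶ B' := Over.homMk (U.left.homOfLE hWBV₀) (by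
      change U.left.homOfLE hWBV₀ ≫ V₀.ι ≫ U.hom = WB.ι ≫ U.hom
      rw [← Category.assoc, Scheme.homOfLE_ι])
    haveI : IsOpenImmersion κ.left := inferInstanceAs (IsOpenImmersion (U.left.homOfLE hWBV₀))
    exact (AlgPoints.isEmbedding_map (L := ℂ) κ).secondCountableTopology
  letI csB := ComplexPoints.chartedSpace B m
  haveI := ComplexPoints.isManifold_real B m
  let b₀ : ComplexPoints B := AlgPoints.liftOfMemOpensRange ιB t₀ (by
    change t₀.pt ∈ (WB.ι).opensRange
    rw [Scheme.Opens.opensRange_ι]; exact ht₀WB)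
  have hb₀ : AlgPoints.map ιB b₀ = t₀ := AlgPoints.map_liftOfMemOpensRange ιB t₀ _
  have heB : IsOpenEmbedding (AlgPoints.map ιB : ComplexPoints B → ComplexPoints U) :=
    AlgPoints.isOpenEmbedding_map_holds ιB
  have hrangeB : Set.range (AlgPoints.map ιB : ComplexPoints B → ComplexPoints U) =
      {t | t.pt ∈ WB} := by
    rw [AlgPoints.range_map_of_isOpenImmersion_holds ιB]
    ext t
    change t.pt ∈ (WB.ι).opensRange ↔ t.pt ∈ WB
    rw [Scheme.Opens.opensRange_ι]
  -- Step 2: the total space `E = f⁻¹ WB` over `B`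
  let E : SchemeOver ℂ := Over.mk ((f.left ⁻¹ᵁ WB).ι ≫ 𝒳.hom)
  let ιE : E ⟶ 𝒳 := Over.homMk (f.left ⁻¹ᵁ WB).ι
  haveI : IsOpenImmersion ιE.left := inferInstanceAs (IsOpenImmersion (Scheme.Opens.ι (f.left ⁻¹ᵁ WB)))
  let g : E ⟶ B := Over.homMk (f.left ∣_ WB) (by
    change (f.left ∣_ WB) ≫ WB.ι ≫ U.hom = (f.left ⁻¹ᵁ WB).ι ≫ 𝒳.hom
    rw [← Category.assoc, morphismRestrict_ι, Category.assoc, Over.w f])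
  haveI : Smooth g.left := inferInstanceAs (Smooth (f.left ∣_ WB))
  haveI : IsProper g.left := inferInstanceAs (IsProper (f.left ∣_ WB))
  have hSm𝒳 : Smooth 𝒳.hom := by rw [← Over.w f]; infer_instance
  haveI : Smooth E.hom := by
    change Smooth ((f.left ⁻¹ᵁ WB).ι ≫ 𝒳.hom)
    infer_instance
  haveI : IsSeparated E.hom := by rw [← Over.w g]; infer_instance
  haveI : LocallyOfFiniteType E.hom := inferInstance
  haveI : CompactSpace E.left := by
    haveI : IsNoetherian (V₀ : Scheme) := {}
    haveI : NoetherianSpace B'.left := inferInstanceAs (NoetherianSpace (V₀ : Scheme))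
    have h1 : IsCompact ((pieceB m : Set B'.left)) := NoetherianSpace.isCompact _
    have h2 : IsCompact (WB : Set U.left) := by
      change IsCompact (V₀.ι.base '' (pieceB m : Set B'.left))
      exact h1.image V₀.ι.base.hom.continuous
    have h3 : IsCompact ((f.left ⁻¹ᵁ WB : 𝒳.left.Opens) : Set 𝒳.left) :=
      QuasiCompact.isCompact_preimage _ WB.isOpen h2
    exact isCompact_iff_compactSpace.mp h3
  haveI : T2Space (ComplexPoints E) := ComplexPoints.t2Space_of_isSeparated E
  haveI : SecondCountableTopology (ComplexPoints E) :=
    ComplexPoints.secondCountableTopology_of_compactSpace_holds E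
  have heE : IsOpenEmbedding (AlgPoints.map ιE : ComplexPoints E → ComplexPoints 𝒳) :=
    AlgPoints.isOpenEmbedding_map_holds ιE
  have hrangeE : Set.range (AlgPoints.map ιE : ComplexPoints E → ComplexPoints 𝒳) =
      {x | x.pt ∈ f.left ⁻¹ᵁ WB} := by
    rw [AlgPoints.range_map_of_isOpenImmersion_holds ιE]
    ext x
    change x.pt ∈ ((f.left ⁻¹ᵁ WB).ι).opensRange ↔ x.pt ∈ f.left ⁻¹ᵁ WB
    rw [Scheme.Opens.opensRange_ι]
  have hcommE : ιE ≫ f = g ≫ ιB := by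
    ext : 1
    exact (morphismRestrict_ι f.left WB).symm
  -- Step 3: the equidimensional pieces of `E`, finitely many
  obtain ⟨piece, hsm, hcov, hdisj, hfin⟩ := exists_smoothPieces E
  obtain ⟨S, hS⟩ := hfin inferInstance
  let EN : ℕ → SchemeOver ℂ := fun N ↦ Over.mk ((piece N).ι ≫ E.hom)
  let jN : ∀ N, EN N ⟶ E := fun N ↦ Over.homMk (piece N).ι
  have hjNoi : ∀ N, IsOpenImmersion (jN N).left := fun N ↦
    inferInstanceAs (IsOpenImmersion (piece N).ι)
  have hrangeN : ∀ N, Set.range (AlgPoints.map (jN N) : ComplexPoints (EN N) → ComplexPoints E) =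
      {x | x.pt ∈ piece N} := fun N ↦ by
    haveI := hjNoi N
    rw [AlgPoints.range_map_of_isOpenImmersion_holds (jN N)]
    ext x
    change x.pt ∈ ((piece N).ι).opensRange ↔ x.pt ∈ piece N
    rw [Scheme.Opens.opensRange_ι]
  -- the pieces are closed on complex points (the complement is the union of the others)
  have hclosedN : ∀ N, IsClosed {x : ComplexPoints E | x.pt ∈ piece N} := fun N ↦ by
    rw [← isOpen_compl_iff]
    have hc : {x : ComplexPoints E | x.pt ∈ piece N}ᶜ =
        ⋃ N' ∈ {N' : ℕ | N' ≠ N}, {x : ComplexPoints E | x.pt ∈ piece N'} := by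
      ext x
      simp only [mem_compl_iff, mem_setOf_eq, mem_iUnion, exists_prop]
      constructor
      · intro hx
        obtain ⟨N', hN'⟩ := hcov x.pt
        exact ⟨N', fun h ↦ hx (h ▸ hN'), hN'⟩
      · rintro ⟨N', hne, hN'⟩ hN
        exact hne (hdisj x N' N hN' hN)
    rw [hc]
    exact isOpen_biUnion fun N' _ ↦ AlgPoints.isOpen_setOf_pt_mem _
  -- Ehresmann for each piece
  have htriv : ∀ N, IsLocallyTrivialFibration
      (AlgPoints.map (jN N ≫ g) : ComplexPoints (EN N) → ComplexPoints B) := fun N ↦ by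
    haveI : SmoothOfRelativeDimension N (EN N).hom := hsm N
    haveI : Smooth (EN N).hom := SmoothOfRelativeDimension.smooth N _
    haveI : LocallyOfFiniteType (EN N).hom := inferInstance
    haveI : IsSeparated (EN N).hom := inferInstanceAs (IsSeparated ((piece N).ι ≫ E.hom))
    haveI : Smooth (jN N ≫ g).left := inferInstanceAs (Smooth ((piece N).ι ≫ g.left))
    haveI : T2Space (ComplexPoints (EN N)) := ComplexPoints.t2Space_of_isSeparated (EN N)
    haveI := hjNoi N
    have hembN := AlgPoints.isEmbedding_map (L := ℂ) (jN N)
    haveI : SecondCountableTopology (ComplexPoints (EN N)) := hembN.secondCountableTopology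
    letI := ComplexPoints.chartedSpace (EN N) N
    haveI := ComplexPoints.isManifold_real (EN N) N
    have hclosed : IsClosedEmbedding (AlgPoints.map (jN N) : ComplexPoints (EN N) → ComplexPoints E) :=
      ⟨hembN, by rw [hrangeN]; exact hclosedN N⟩
    have hproper : IsProperMap (AlgPoints.map (jN N ≫ g) : ComplexPoints (EN N) → ComplexPoints B) := by
      rw [AlgPoints.map_comp]
      exact (AlgPoints.isProperMap_map g).comp hclosed.isProperMap
    exact ehresmann_fibration_holds (2 * N) (2 * m) (ComplexPoints (EN N)) (ComplexPoints B)
      (AlgPoints.map (jN N ≫ g)) (ComplexPoints.contMDiff_map (jN N ≫ g)) hproper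
      (ComplexPoints.surjective_mfderiv_map (jN N ≫ g))
  -- Step 4: glue the trivialisations of the finitely many pieces over a neighbourhood of `t₀`
  obtain ⟨V₁, hV₁o, ht₀V₁, hglue⟩ := exists_trivialization_of_pieces
    (ι := S) (E := fun i ↦ ComplexPoints (EN i.1))
    (AlgPoints.map f) (AlgPoints.continuous_map f) (AlgPoints.map ιB) heB
    (fun i ↦ AlgPoints.map (jN i.1 ≫ ιE)) (fun i ↦ by
      haveI := hjNoi i.1
      haveI : IsOpenImmersion (jN i.1 ≫ ιE).left := IsOpenImmersion.comp (jN i.1).left ιE.left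
      exact AlgPoints.isOpenEmbedding_map_holds _)
    (fun i i' z z' h ↦ by
      apply Subtype.ext
      rw [AlgPoints.map_comp_apply, AlgPoints.map_comp_apply] at h
      have h' := heE.injective h
      have h1 : (AlgPoints.map (jN i.1) z).pt ∈ piece i.1 := by
        rw [← mem_setOf_eq (p := fun x : ComplexPoints E ↦ x.pt ∈ piece i.1), ← hrangeN]
        exact mem_range_self _
      have h2 : (AlgPoints.map (jN i.1) z).pt ∈ piece i'.1 := by
        rw [h', ← mem_setOf_eq (p := fun x : ComplexPoints E ↦ x.pt ∈ piece i'.1), ← hrangeN]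
        exact mem_range_self _
      exact hdisj _ _ _ h1 h2)
    (fun x hx ↦ by
      rw [hrangeB] at hx
      have hx' : x ∈ Set.range (AlgPoints.map ιE : ComplexPoints E → ComplexPoints 𝒳) := by
        rw [hrangeE]; exact hx
      obtain ⟨y, rfl⟩ := hx'
      obtain ⟨N, hNS, hyN⟩ := hS y.pt
      have hy : y ∈ Set.range (AlgPoints.map (jN N) : ComplexPoints (EN N) → ComplexPoints E) := by
        rw [hrangeN]; exact hyN
      obtain ⟨z, rfl⟩ := hy
      exact ⟨⟨N, hNS⟩, z, AlgPoints.map_comp_apply _ _ z⟩)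
    (fun i ↦ AlgPoints.map (jN i.1 ≫ g))
    (fun i z ↦ by
      rw [← AlgPoints.map_comp_apply, ← AlgPoints.map_comp_apply, Category.assoc, hcommE,
        Category.assoc])
    b₀ (fun i ↦ htriv i.1 b₀)
  rw [hb₀] at ht₀V₁ hglue
  exact ⟨V₁, hV₁o, ht₀V₁, hglue V₁ Subset.rfl⟩

/-- **`f(ℂ)` is a Serre fibration** for `f` smooth and proper over a smooth `ℂ`-scheme.
[cite: VoisinHodgeI2002, Thm. 9.3] [cite: HatcherAT2002, §4.2 Prop. 4.48] -/
theorem isSerreFibration_map_of_smooth_proper {U 𝒳 : SchemeOver ℂ} (f : 𝒳 ⟶ U)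
    [Smooth U.hom] [Smooth f.left] [IsProper f.left] :
    IsSerreFibration (AlgPoints.map f : ComplexPoints 𝒳 → ComplexPoints U) :=
  (isLocallyTrivialFibration_map_of_smooth_proper f).isSerreFibration (AlgPoints.continuous_map f)

end Literature.AlgebraicGeometry.Motives

end
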